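import Literature.Computability.AlgebraicComplexity.BI17TensorGenericWitnessCertificates
import Literature.Computability.AlgebraicComplexity.TensorGenericPolystability
import HarnessLib

/-!
# BI 2017 Prop. 4.10, Popov's tensor criterion and Cor. 5.12 — discharged

The closer of the programme "generic polystability of 3-tensors by Mumford's route": the named facts
`BI2017_prop_4_10` ("Almost all `w ∈ ⊗³ℂ^m` are polystable", `BI17FundamentalInvariantTensors.lean`),
`Popov1970_genericClosedOrbit_tensor` (the typed instance on `⊗³ℂ^m` of Popov's 1970 stability
criterion, `PopovStabilityCriterionTensor.lean`) and `BI2017_cor_5_12` (through the tree's edge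
`BI2017_cor_5_12_of_thm_4_2_of_prop_4_10` and `BI2017_thm_4_2_holds`) become theorems.

Inputs, all theorems of the tree:
* the explicit sparse tensors `genericWitness n ∈ ⊗³ℂ^{n+3}`
  (`v_m = ∑_i 2 e_i⊗e_i⊗e_i + e_i⊗e_{i+1}⊗e_{i+2} + e_i⊗e_{i+2}⊗e_{i+1}`, indices mod `m = n + 3`), which
  are polystable (`isPolystableTensor_genericWitness`: free support with uniform marginals, the
  corrected BI Prop. 4.8 criterion) and have zero traceless infinitesimal stabilizer
  (`hasTrivialSL3LieStabilizer_genericWitness_of_two_le` for `m ≥ 5` by elimination,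
  `…_zero`, `…_one` for `m = 3, 4` by kernel-checked integer certificates;
  `BI17TensorGenericWitness.lean`, `BI17TensorGenericWitnessCertificates.lean`; the all-`n` packaging
  `hasTrivialSL3LieStabilizer_genericWitness` / `exists_stable_genericWitness` is also recorded in
  `BI17TensorGenericWitnessStable.lean`; this file assembles the three cases directly from the two
  witness files, so that it depends on them alone);
* `BI2017_prop_4_10_of_exists_stable_add_three` (`TensorGenericPolystability.lean`): one such STABLE
  tensor per format `m ≥ 3` makes polystability Zariski-generic (bad locus cut out by minors and
  `SL³`-stable; Reynolds separation of the closed orbit from it; the invariant is constant on orbit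
  closures; compactness half of Hilbert–Mumford/Kempf–Ness), `m ≤ 2` from the tree.

The route is Mumford's (GIT Ch. 1 §2, Ch. 4 §2) made explicit, not the printed one-line proof of
BI Prop. 4.10 (which quotes Popov 1970 / Luna 1973 / Kraft 1984 II.4.3.D for "generically finite
stabilizer ⇒ generically closed orbit"); the typed Popov instance follows because its conclusion holds
outright. Theorem-only file (no definitions, no named facts). Honest framing: classical invariant
theory of `SL_m^3` on `⊗³ℂ^m`; bookkeeping for the BI 2017 rows; nothing here bears on VP versus VNP.

## References

* P. Bürgisser, C. Ikenmeyer, *Fundamental invariants of orbit closures*, J. Algebra 477 (2017),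
  Prop. 4.10, Thm. 4.2, Cor. 5.12. [BurgisserIkenmeyer2017]
* V. L. Popov, *Stability criteria for the action of a semisimple group on a factorial manifold*,
  Izv. Akad. Nauk SSSR 34 (1970), 523–531. [Popov1970]
* D. Mumford, J. Fogarty, F. Kirwan, *Geometric Invariant Theory*, 3rd ed. (1994), Ch. 1 §2,
  Ch. 4 §2. [MumfordFogartyKirwan1994]
-/

noncomputable section

namespace Literature.Computability.AlgebraicComplexity

/-- The witness tensors have zero traceless infinitesimal stabilizer in every format `m = n + 3`
(`m = 3, 4`: kernel certificates; `m ≥ 5`: elimination) — local assembly of the three cases (the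
same statement is `hasTrivialSL3LieStabilizer_genericWitness` of `BI17TensorGenericWitnessStable.lean`).
[cite: BurgisserIkenmeyer2017, Prop. 4.10 (proof)] -/
private theorem hasTrivialSL3LieStabilizer_genericWitness_all :
    ∀ n : ℕ, HasTrivialSL3LieStabilizer (genericWitness n)
  | 0 => hasTrivialSL3LieStabilizer_genericWitness_zero
  | 1 => hasTrivialSL3LieStabilizer_genericWitness_one
  | k + 2 => hasTrivialSL3LieStabilizer_genericWitness_of_two_le (k + 2) (by omega)

/-- **BI 2017, Prop. 4.10 — DISCHARGED** ("Almost all `w ∈ ⊗³ℂ^m` are polystable", every `m`):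
Mumford's route `BI2017_prop_4_10_of_exists_stable_add_three` fed with the stable witnesses
`genericWitness n` (`isPolystableTensor_genericWitness`, zero traceless infinitesimal stabilizer).
[cite: BurgisserIkenmeyer2017, Prop. 4.10] -/
theorem BI2017_prop_4_10_holds : BI2017_prop_4_10 :=
  BI2017_prop_4_10_of_exists_stable_add_three fun n =>
    ⟨genericWitness n, isPolystableTensor_genericWitness n, hasTrivialSL3LieStabilizer_genericWitness_all n⟩

/-- **Popov's 1970 stability criterion on `⊗³ℂ^m`, typed instance — DISCHARGED**: for `m ≥ 2`,
"generically finite `SL_m^3`-stabilizer ⇒ generically closed `SL_m^3`-orbit" holds because the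
conclusion holds outright (`BI2017_prop_4_10_holds`).
[cite: Popov1970, Theorem] [cite: BurgisserIkenmeyer2017, Prop. 4.10 (proof)] -/
theorem Popov1970_genericClosedOrbit_tensor_holds : Popov1970_genericClosedOrbit_tensor :=
  fun m _ _ => BI2017_prop_4_10_holds m

/-- **BI 2017, Cor. 5.12 — DISCHARGED**: the tree's edge `BI2017_cor_5_12_of_thm_4_2_of_prop_4_10`
fed with `BI2017_thm_4_2_holds` and `BI2017_prop_4_10_holds`.
[cite: BurgisserIkenmeyer2017, Cor. 5.12] -/
theorem BI2017_cor_5_12_holds : BI2017_cor_5_12 :=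
  BI2017_cor_5_12_of_thm_4_2_of_prop_4_10 BI2017_thm_4_2_holds BI2017_prop_4_10_holds

end Literature.Computability.AlgebraicComplexity

end
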